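import Summits.QuantumFields.QCD.Theorems.PauliWegnerSeaFMClosureUnquenchedDefs
import Literature.MathematicalPhysics.QuantumLattice.TwistedFreeWilsonDirac

/-!
# Side witness, part 2: polynomial rigidity on the circle, diagonal `SU(3)` twists, torus steps

Crux `FMClosureUnquenched` (stmt-QuantumFields-11512), line `von-mises-circles`, registered sub-goal
`c1_sideWitness : SideWitness`.  Three independent tool kits for the side witness:

* `exists_circle_det_ne_zero` (= registered `c1_sideWitness_aux2`): if `det M₀ ≠ 0` then
  `det (M₀ + t M₁ + t² M₂ + t⁴ M₄) ≠ 0` for some `t` on the unit circle (a nonzero polynomial has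
  finitely many roots, the circle is infinite);
* the diagonal twist `g_t = diag(t̄, t̄, t²) ∈ SU(3)` (`exists_su3_diag`) and the three entrywise
  products of the colour row-scaling `(t, t, t²)` with `g_t`, `g_t⁻¹ = g_t^*`, `1` that turn the
  twisted side matrix into a polynomial matrix in `t`;
* elementary facts about the eight unit steps `± e_μ` of the torus `(ℤ/N)⁴`, `N ≥ 3`.
-/

namespace Summit.QuantumFields.QCD.Theorems.VonMisesCirclesC1

open Matrix Polynomial Literature.MathematicalPhysics.QuantumLattice Literature.Probability.LatticeModels
open Summit.QuantumFields.QCD.Theorems.VonMisesCircles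
open scoped ComplexConjugate

/-! ## Polynomial rigidity on the unit circle -/

/-- The unit circle of `ℂ` is an infinite set. -/
theorem unitCircle_infinite : ({t : ℂ | ‖t‖ = 1} : Set ℂ).Infinite := by
  haveI : Infinite Circle :=
    Circle.argEquiv.infinite_iff.2 (Set.Ioc.infinite (by linarith [Real.pi_pos]))
  exact Set.infinite_of_injective_forall_mem (f := fun z : Circle => (z : ℂ))
    (fun z w h => Circle.ext h) (fun z => by simp)

/-- **Polynomial rigidity on the circle** (registered `c1_sideWitness_aux2`): if the constant term
`M₀` of the matrix polynomial `M₀ + t M₁ + t² M₂ + t⁴ M₄` is nonsingular, the polynomial is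
nonsingular at some point of the unit circle. -/
theorem exists_circle_det_ne_zero {n : Type*} [Fintype n] [DecidableEq n]
    (M₀ M₁ M₂ M₄ : Matrix n n ℂ) (h0 : M₀.det ≠ 0) :
    ∃ t : ℂ, ‖t‖ = 1 ∧ (M₀ + t • M₁ + t ^ 2 • M₂ + t ^ 4 • M₄).det ≠ 0 := by
  classical
  set P : Matrix n n ℂ[X] := M₀.map Polynomial.C + (Polynomial.X : ℂ[X]) • M₁.map Polynomial.C +
    (Polynomial.X ^ 2 : ℂ[X]) • M₂.map Polynomial.C + (Polynomial.X ^ 4 : ℂ[X]) • M₄.map Polynomial.C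
    with hP
  have heval : ∀ t : ℂ, (P.det).eval t = (M₀ + t • M₁ + t ^ 2 • M₂ + t ^ 4 • M₄).det := by
    intro t
    rw [← Polynomial.coe_evalRingHom, RingHom.map_det]
    congr 1
    ext i j
    simp [hP, Matrix.add_apply, Matrix.smul_apply, Matrix.map_apply]
    ring
  have hne : P.det ≠ 0 := by
    intro h
    have h1 := heval 0
    rw [h, Polynomial.eval_zero] at h1
    simp only [zero_smul, add_zero, ne_eq, OfNat.ofNat_ne_zero, not_false_eq_true, zero_pow] at h1
    exact h0 h1.symm
  by_contra hall
  push Not at hall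
  apply hne
  apply Polynomial.eq_zero_of_infinite_isRoot
  refine Set.Infinite.mono (fun t ht => ?_) unitCircle_infinite
  simp only [Set.mem_setOf_eq] at ht ⊢
  rw [Polynomial.IsRoot.def, heval]
  exact hall t ht

/-! ## The diagonal twist `diag(t̄, t̄, t²)` -/

/-- On the unit circle `t̄ t = 1`. -/
theorem conj_mul_self_of_norm_eq_one {t : ℂ} (ht : ‖t‖ = 1) : conj t * t = 1 := by
  rw [Complex.conj_mul', ht]; simp

/-- On the unit circle `t t̄ = 1`. -/
theorem self_mul_conj_of_norm_eq_one {t : ℂ} (ht : ‖t‖ = 1) : t * conj t = 1 := by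
  rw [mul_comm]; exact conj_mul_self_of_norm_eq_one ht

/-- The diagonal twist `diag(t̄, t̄, t²)` is special unitary for `|t| = 1`. -/
theorem diag_mem_specialUnitaryGroup {t : ℂ} (ht : ‖t‖ = 1) :
    Matrix.diagonal ![conj t, conj t, t ^ 2] ∈ Matrix.specialUnitaryGroup (Fin 3) ℂ := by
  have h1 := conj_mul_self_of_norm_eq_one ht
  have h2 := self_mul_conj_of_norm_eq_one ht
  rw [Matrix.mem_specialUnitaryGroup_iff, Matrix.mem_unitaryGroup_iff, Matrix.det_diagonal]
  refine ⟨?_, ?_⟩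
  · rw [Matrix.star_eq_conjTranspose, Matrix.diagonal_conjTranspose, Matrix.diagonal_mul_diagonal,
      ← Matrix.diagonal_one]
    congr 1
    funext a
    fin_cases a
    · simp [h1]
    · simp [h1]
    · simp only [Fin.reduceFinMk, Matrix.cons_val, Pi.star_apply, star_pow, Complex.star_def]
      rw [← mul_pow, h2, one_pow]
  · rw [Fin.prod_univ_three]
    simp only [Matrix.cons_val_zero, Matrix.cons_val_one, Matrix.cons_val_two, Matrix.tail_cons,
      Matrix.head_cons]
    calc conj t * conj t * t ^ 2 = (conj t * t) * (conj t * t) := by ring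
      _ = 1 := by rw [h1, one_mul]

/-- A special unitary element with underlying matrix `diag(t̄, t̄, t²)`. -/
theorem exists_su3_diag {t : ℂ} (ht : ‖t‖ = 1) :
    ∃ g : Matrix.specialUnitaryGroup (Fin 3) ℂ,
      (g : Matrix (Fin 3) (Fin 3) ℂ) = Matrix.diagonal ![conj t, conj t, t ^ 2] :=
  ⟨⟨_, diag_mem_specialUnitaryGroup ht⟩, rfl⟩

/-- The inverse of `g_t` in `SU(3)` has underlying matrix `diag(t, t, t̄²)`. -/
theorem coe_inv_su3_diag {t : ℂ} (g : Matrix.specialUnitaryGroup (Fin 3) ℂ)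
    (hg : (g : Matrix (Fin 3) (Fin 3) ℂ) = Matrix.diagonal ![conj t, conj t, t ^ 2]) :
    ((g⁻¹ : Matrix.specialUnitaryGroup (Fin 3) ℂ) : Matrix (Fin 3) (Fin 3) ℂ) =
      Matrix.diagonal ![t, t, conj t ^ 2] := by
  rw [← Matrix.star_eq_inv, Matrix.specialUnitaryGroup.coe_star, hg, Matrix.star_eq_conjTranspose,
    Matrix.diagonal_conjTranspose]
  congr 1
  funext a
  fin_cases a <;> simp

/-- Row scaling times `g_t`: exponents `(0, 0, 4)`. -/
theorem rowScale_mul_diag {t : ℂ} (ht : ‖t‖ = 1) (c c' : Fin 3) :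
    (![t, t, t ^ 2] c) * (Matrix.diagonal ![conj t, conj t, t ^ 2]) c c' =
      if c = c' then t ^ (![0, 0, 4] c : ℕ) else 0 := by
  have h2 := self_mul_conj_of_norm_eq_one ht
  fin_cases c <;> fin_cases c' <;> (simp [Matrix.diagonal, h2]; try ring)

/-- Row scaling times `g_t⁻¹`: exponents `(2, 2, 0)`. -/
theorem rowScale_mul_diag_inv {t : ℂ} (ht : ‖t‖ = 1) (c c' : Fin 3) :
    (![t, t, t ^ 2] c) * (Matrix.diagonal ![t, t, conj t ^ 2]) c c' =
      if c = c' then t ^ (![2, 2, 0] c : ℕ) else 0 := by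
  have h2 := self_mul_conj_of_norm_eq_one ht
  fin_cases c <;> fin_cases c' <;> simp [Matrix.diagonal]
  · ring
  · ring
  · rw [← mul_pow, h2, one_pow]

/-- Row scaling times `1`: exponents `(1, 1, 2)`. -/
theorem rowScale_mul_one (t : ℂ) (c c' : Fin 3) :
    (![t, t, t ^ 2] c) * (1 : Matrix (Fin 3) (Fin 3) ℂ) c c' =
      if c = c' then t ^ (![1, 1, 2] c : ℕ) else 0 := by
  fin_cases c <;> fin_cases c' <;> simp

/-! ## Unit steps of the torus `(ℤ/N)⁴`, `N ≥ 3` -/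

/-- `1 ≠ 0` in `ℤ/N` for `N ≥ 2`. -/
theorem zmod_one_ne_zero {N : ℕ} (hN : 2 ≤ N) : (1 : ZMod N) ≠ 0 := by
  haveI : Fact (1 < N) := ⟨hN⟩
  exact one_ne_zero

/-- `1 ≠ -1` in `ℤ/N` for `N ≥ 3`. -/
theorem zmod_one_ne_neg_one {N : ℕ} (hN : 3 ≤ N) : (1 : ZMod N) ≠ -1 := by
  intro h
  have h2 : ((2 : ℕ) : ZMod N) = 0 := by
    rw [Nat.cast_ofNat]
    linear_combination h
  rw [ZMod.natCast_eq_zero_iff] at h2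
  have := Nat.le_of_dvd (by norm_num) h2
  omega

/-- The unit step of label `(μ, b)`: `+e_μ` (`b = false`) or `-e_μ` (`b = true`) is nonzero. -/
theorem step_ne_zero {N : ℕ} (hN : 2 ≤ N) (ℓ : Fin 4 × Bool) :
    (if ℓ.2 then -(Pi.single ℓ.1 1 : TorusSite 4 N) else Pi.single ℓ.1 1) ≠ 0 := by
  have h1 := zmod_one_ne_zero hN
  intro h
  have h' := congrFun h ℓ.1
  split_ifs at h' with hb <;> simp [h1] at h'

/-- Distinct labels give distinct steps (`N ≥ 3`). -/
theorem step_injective {N : ℕ} (hN : 3 ≤ N) {ℓ ℓ' : Fin 4 × Bool}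
    (h : (if ℓ.2 then -(Pi.single ℓ.1 1 : TorusSite 4 N) else Pi.single ℓ.1 1) =
      (if ℓ'.2 then -(Pi.single ℓ'.1 1 : TorusSite 4 N) else Pi.single ℓ'.1 1)) : ℓ = ℓ' := by
  have h1 := zmod_one_ne_zero (show 2 ≤ N by omega)
  have h2 := zmod_one_ne_neg_one hN
  obtain ⟨μ, b⟩ := ℓ
  obtain ⟨ν, b'⟩ := ℓ'
  simp only at h
  have hμ := congrFun h μ
  have hν := congrFun h ν
  by_cases hμν : μ = ν
  · subst hμν
    obtain _ | _ := b <;> obtain _ | _ := b'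
    · rfl
    · exfalso
      simp only [Bool.false_eq_true, ite_false, ite_true, Pi.neg_apply, Pi.single_eq_same] at hμ
      exact h2 hμ
    · exfalso
      simp only [Bool.false_eq_true, ite_false, ite_true, Pi.neg_apply, Pi.single_eq_same] at hμ
      exact h2 hμ.symm
    · rfl
  · exfalso
    cases b <;> cases b' <;> simp [hμν, h1] at hμ

/-- A step never fixes a site. -/
theorem add_step_ne_self {N : ℕ} (hN : 2 ≤ N) (x : TorusSite 4 N) (ℓ : Fin 4 × Bool) :
    x + (if ℓ.2 then -(Pi.single ℓ.1 1 : TorusSite 4 N) else Pi.single ℓ.1 1) ≠ x := by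
  intro h
  exact step_ne_zero hN ℓ (add_eq_left.1 h)

/-- Equal targets force equal labels (`N ≥ 3`). -/
theorem label_eq_of_add_step_eq {N : ℕ} (hN : 3 ≤ N) (x : TorusSite 4 N) {ℓ ℓ' : Fin 4 × Bool}
    (h : x + (if ℓ.2 then -(Pi.single ℓ.1 1 : TorusSite 4 N) else Pi.single ℓ.1 1) =
      x + (if ℓ'.2 then -(Pi.single ℓ'.1 1 : TorusSite 4 N) else Pi.single ℓ'.1 1)) : ℓ = ℓ' :=
  step_injective hN (add_left_cancel h)

/-- The forward shift of the tree is the step `(μ, false)`. -/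
theorem shift_eq_add_step {N : ℕ} (x : TorusSite 4 N) (μ : Fin 4) :
    Literature.MathematicalPhysics.QuantumFieldTheory.Site.shift x μ =
      x + (if ((μ, false) : Fin 4 × Bool).2 then -(Pi.single ((μ, false) : Fin 4 × Bool).1 1 :
        TorusSite 4 N) else Pi.single ((μ, false) : Fin 4 × Bool).1 1) := rfl

/-- `x = y + e_μ` iff `y = x - e_μ`, i.e. `y` is the `(μ, true)` step of `x`. -/
theorem eq_shift_iff_eq_add_step {N : ℕ} (x y : TorusSite 4 N) (μ : Fin 4) :
    x = Literature.MathematicalPhysics.QuantumFieldTheory.Site.shift y μ ↔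
      y = x + (if ((μ, true) : Fin 4 × Bool).2 then -(Pi.single ((μ, true) : Fin 4 × Bool).1 1 :
        TorusSite 4 N) else Pi.single ((μ, true) : Fin 4 × Bool).1 1) := by
  simp only [Literature.MathematicalPhysics.QuantumFieldTheory.Site.shift, ite_true]
  constructor
  · intro h; rw [h]; abel
  · intro h; rw [h]; abel

/-- **Registered helper `c1_sideWitness_aux2` of crux stmt-QuantumFields-11512** (line `von-mises-circles`,
sub-goal `c1_sideWitness`): polynomial rigidity on the unit circle for quark-index matrices. -/
theorem c1_sideWitness_aux2 : ∀ (N : ℕ) [NeZero N] (M₀ M₁ M₂ M₄ : Matrix (QIdx N) (QIdx N) ℂ), M₀.det ≠ 0 → ∃ t : ℂ, ‖t‖ = 1 ∧ (M₀ + t • M₁ + t ^ 2 • M₂ + t ^ 4 • M₄).det ≠ 0 :=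
  fun _ _ M₀ M₁ M₂ M₄ h0 => exists_circle_det_ne_zero M₀ M₁ M₂ M₄ h0

end Summit.QuantumFields.QCD.Theorems.VonMisesCirclesC1
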